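import Summits.MatrixMultiplication.MatrixMultiplication.Theorems.ObstructionCalculusInvariants
import Literature.Computability.AlgebraicComplexity.IsotypicOccurrenceSemigroup

set_option linter.dupNamespace false
set_option autoImplicit false

/-!
# The obstruction calculus — SCHUR–WEYL BRIDGE between the two occurrence models (decomp-mm · lens 3 · gen 29, def-free)

Route-free calculus part (imports `ObstructionCalculusInvariants` and Literature only — no `Theses` file, lint `theses-cone`),
SUPPORTING the crux `NoOccurrenceObstruction` (`P_O`, stmt 29040) of `route-MatrixMultiplication-ObstructionDescent`; the
one consequence stated against the route decl by name is in `ObstructionDescentSchurWeylObligation`.  NODE-g29 §1.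

The route's obstruction calculus (`ObstructionCalculus*`: weight-vector spaces `hwvSpace Λ d ⊆ ℂ[ℂ^m ⊗ ℂ^m ⊗ ℂ^m]_d`,
orbit ideals `orbitVanishing t`; "the type `(Λ,d)` OCCURS for `t`" = `¬ hwvSpace Λ d ≤ orbitVanishing t`) and the Literature's
isotypic model of Bürgisser–Ikenmeyer's semigroup `S(t)` (`IsotypicOccurrenceSemigroup`, `UnitTensorMomentPolytope*`,
`UnitTensorSLObstructions*`: "`λ ⊢ d` OCCURS in `t^{⊗d}`" = `isotypicSum₁ λ⁰ (isotypicSum₂ λ¹ (isotypicSum₃ λ² (kroneckerPow t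
d))) ≠ 0`) had no typed connection in the tree.  This file certifies the translation in the direction the crux consumes:
* §1 DENSITY for an ARBITRARY tensor `t` (`evalT_actTensor_eq_zero_of_generic`; the tree had `t = ⟨m⟩` only): a polynomial
  vanishing on `GL_m³·t` vanishes on `Mat_m³·t`; hence `orbitVanishing t ≤ orbitVanishing ((A,B,C)·t)` — occurrence can only
  decrease under restriction / degeneration (`S((A,B,C)·t) ⊆ S(t)` in the polynomial model).
* §2 THE DICTIONARY (`exists_pairing_mem_hwvSpace`): for highest-weight vectors `ξ₁, ξ₂, ξ₃` of weights `λ⁰, λ¹, λ²` in the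
  word models `(ℂ^m)^{⊗d}`, the pairing polynomial `F(s) = ⟪(s∘rev³)^{⊗d}, ξ₁ ⊗ ξ₂ ⊗ ξ₃⟫` lies in `hwvSpace Λ d` for the
  REVERSED type `Λ s (rev i) = λˢ_i` (the calculus' upper-triangular Borel acts by substitution, so its types come out
  increasing, cf. `monotone_of_hwvSpace_ne_bot`; the coordinate reversal is conjugation by the longest Weyl element).
* §3 THE BRIDGE, direction ⟸ (`not_hwvSpace_le_orbitVanishing_of_isotypicSum_ne_zero`): `(d;λ) ∈ S(t)` in the isotypic
  model ⟹ the reversed type `(Λ,d)` occurs for `t` in the calculus (Schur–Weyl duality in span form, tree, + §1 + §2).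
* §4 IMPORTS.  (a) zero-padding does not change isotypic occurrence (`isotypicSum_kroneckerPow_padTensor_ne_zero_iff`);
  (b) `S(⟨n,n,n⟩)` lands in the calculus: a triple occurring in `⟨n,n,n⟩^{⊗d}` is, reversed, a LIVE type of `pad_m⟨n,n,n⟩` in
  EVERY format `m ≥ n²`, hence of `⟨m⟩` once `R(⟨n,n,n⟩) ≤ m`; (c) so the crux `P_O` carries the explicit OBLIGATION
  (`ObstructionDescentSchurWeylObligation.noOccurrenceObstruction_obligation`): for every `τ > 2`, eventually in `n`, every
  element of `S(⟨n,n,n⟩)` must occur (reversed) in `ℂ[σ_m]` for every format `m ≥ n^τ` — a statement about the unit tensor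
  alone.  First concrete member: the
  BI type `((2n²−3,1,1,1), 2^{n²}, 2^{n²}) ⊢ 2n²` (occurs in `⟨n,n,n⟩^{⊗2n²}`: PROVED in the tree,
  `isotypicSum_bi2011_kroneckerPow_matMulTensor_ne_zero`, module `UnitTensorSLObstructionsOccurrence`, not imported here;
  does not occur in `⟨n²+1⟩^{⊗2n²}`: BI 2011 Lemma 6.1) — the obligation is open in the window `n^τ ≤ m < R̲(⟨n,n,n⟩)`.

No proposition is defined; no `def`; sorry-free; standard axioms.  Nothing here proves `ω = 2` or closes an item.
[cite: BurgisserIkenmeyer2011, §3.1 (S(w), orbit closures), §10.1 (highest weight vectors of `𝒪(W)`), Lemma 6.1]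
[cite: ChristandlVranaZuiddam2023, §3.1] [cite: FultonHarrisGTM129, §15.3, Thm. 6.3]
-/

noncomputable section

open scoped BigOperators Matrix
open Finset

namespace Summit.MatrixMultiplication.MatrixMultiplication.Theorems.ObstructionCalculus

open Literature.Computability.AlgebraicComplexity (triad triad_apply actTensor actTensor_apply actTensor_triad
  actTensor_actTensor actTensor_one kroneckerPow kroneckerPow_apply powMat powMat_apply transpose_powMat
  sum_actTensor_mul kroneckerPow_actTensor_powMat isotypicSum₁ isotypicSum₂ isotypicSum₃ matMulTensor unitTensor
  tensorRank wordRep_eq_powMat_mulVec exists_pairing_ne_zero_of_isotypicSum₁₂₃_kroneckerPow_ne_zero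
  isotypicSum₁₂₃_kroneckerPow_ne_zero_of_actTensor)
open Literature.NumberTheory.DiophantineGeometry (Word wordRep highestWeightSpace Weight IsUpperTriangular)

/-! ### §1 Density of `GL_m³·t` in `Mat_m³·t`, for an arbitrary tensor `t` -/

section Density

variable {m : ℕ}

/-- **Density of `GL_m³·t` in `Mat_m³·t` (polynomial form, arbitrary `t`).** A polynomial vanishing at `(A,B,C)·t` for all
INVERTIBLE `A, B, C` vanishes there for ALL `A, B, C`: the pull-back `P(A,B,C) = f((A,B,C)·t)` to the generic matrices
satisfies `P · det A · det B · det C ≡ 0` as a function, hence as a polynomial (`MvPolynomial.funext`), and the triple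
determinant is a non-zero element of the domain `ℂ[A,B,C]`.  (The tree's `evalT_fromCols_eq_zero_of_generic` is the case
`t = ⟨m⟩`.) [cite: BurgisserIkenmeyer2011, §3.1 (Zariski closure of the orbit)] -/
theorem evalT_actTensor_eq_zero_of_generic (t : Tensor ℂ m) (f : MvPolynomial (Idx m) ℂ)
    (h : ∀ A B C : Matrix (Fin m) (Fin m) ℂ, A.det ≠ 0 → B.det ≠ 0 → C.det ≠ 0 →
      evalT (actTensor A B C t) f = 0)
    (A B C : Matrix (Fin m) (Fin m) ℂ) : evalT (actTensor A B C t) f = 0 := by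
  classical
  set Q : Idx m → MvPolynomial (MIdx m) ℂ := fun p =>
    actTensor (genMat (m := m) 0) (genMat 1) (genMat 2) (fun a b c => MvPolynomial.C (t a b c)) p.1 p.2.1 p.2.2
    with hQ
  set P : MvPolynomial (MIdx m) ℂ := MvPolynomial.bind₁ Q f with hPdef
  set D : MvPolynomial (MIdx m) ℂ :=
    (genMat (m := m) 0).det * (genMat (m := m) 1).det * (genMat (m := m) 2).det with hD
  -- evaluating the generic translate at an assignment is translating by the assigned matrices
  have hQe : ∀ (e : MIdx m → ℂ) (p : Idx m), MvPolynomial.aeval e (Q p) =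
      actTensor (matOf e 0) (matOf e 1) (matOf e 2) t p.1 p.2.1 p.2.2 := by
    intro e p
    simp only [hQ, actTensor_apply, map_sum, map_mul, MvPolynomial.aeval_C, Algebra.algebraMap_self_apply, genMat, matOf,
      MvPolynomial.aeval_X]
  have hP : ∀ e : MIdx m → ℂ,
      MvPolynomial.aeval e P = evalT (actTensor (matOf e 0) (matOf e 1) (matOf e 2) t) f := by
    intro e
    have hfun : (fun p : Idx m => MvPolynomial.aeval e (Q p)) =
        fun p : Idx m => actTensor (matOf e 0) (matOf e 1) (matOf e 2) t p.1 p.2.1 p.2.2 :=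
      funext fun p => hQe e p
    rw [hPdef, MvPolynomial.aeval_bind₁, hfun]
    rfl
  have hDe : ∀ e : MIdx m → ℂ,
      MvPolynomial.aeval e D = (matOf e 0).det * (matOf e 1).det * (matOf e 2).det := by
    intro e
    rw [hD, map_mul, map_mul, aeval_det_genMat, aeval_det_genMat, aeval_det_genMat]
  -- `P * D` vanishes everywhere, hence is the zero polynomial
  have hPD : P * D = 0 := by
    apply MvPolynomial.funext
    intro e
    rw [map_zero, map_mul]
    change MvPolynomial.aeval e P * MvPolynomial.aeval e D = 0
    by_cases hdet : MvPolynomial.aeval e D = 0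
    · rw [hdet, mul_zero]
    · rw [hDe] at hdet
      have hA : (matOf e 0).det ≠ 0 := fun h0 => hdet (by rw [h0, zero_mul, zero_mul])
      have hB : (matOf e 1).det ≠ 0 := fun h0 => hdet (by rw [h0, mul_zero, zero_mul])
      have hC : (matOf e 2).det ≠ 0 := fun h0 => hdet (by rw [h0, mul_zero])
      rw [hP, h _ _ _ hA hB hC, zero_mul]
  -- `D ≠ 0`: it evaluates to `1` at the identity matrices
  have hD0 : D ≠ 0 := by
    intro hD0
    obtain ⟨e, he0, he1, he2⟩ := matOf_entries (m := m) 1 1 1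
    have := hDe e
    rw [hD0, map_zero, he0, he1, he2, Matrix.det_one, mul_one, mul_one] at this
    exact zero_ne_one this
  have hP0 : P = 0 := (mul_eq_zero.1 hPD).resolve_right hD0
  obtain ⟨e, he0, he1, he2⟩ := matOf_entries A B C
  have := hP e
  rw [hP0, map_zero, he0, he1, he2] at this
  exact this.symm

/-- A polynomial vanishing on the orbit `GL_m³·t` vanishes on every restriction `(A ⊗ B ⊗ C)·t`, invertible or not.
[cite: BurgisserIkenmeyer2011, §3.1] -/
theorem evalT_actTensor_eq_zero_of_mem_orbitVanishing {t : Tensor ℂ m} {f : MvPolynomial (Idx m) ℂ}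
    (hf : f ∈ orbitVanishing t) (A B C : Matrix (Fin m) (Fin m) ℂ) : evalT (actTensor A B C t) f = 0 :=
  evalT_actTensor_eq_zero_of_generic t f (fun A' B' C' hA hB hC => hf A' B' C' hA hB hC) A B C

/-- **Orbit-closure ideals grow under restriction** (`S` decreases under degeneration, polynomial model): every polynomial
vanishing on `GL_m³·t` vanishes on `GL_m³·((A₀,B₀,C₀)·t)`, for arbitrary square `A₀, B₀, C₀`.  The tree's
`orbitVanishing_unitTensor_le` is the case `t = ⟨m⟩`. [cite: BurgisserIkenmeyer2011, §3.1 and Prop. 3.3] -/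
theorem orbitVanishing_le_orbitVanishing_actTensor (t : Tensor ℂ m) (A₀ B₀ C₀ : Matrix (Fin m) (Fin m) ℂ) :
    orbitVanishing t ≤ orbitVanishing (actTensor A₀ B₀ C₀ t) := by
  intro f hf A B C _ _ _
  rw [actTensor_actTensor]
  exact evalT_actTensor_eq_zero_of_mem_orbitVanishing hf _ _ _

/-- **Occurrence is monotone under restriction** (calculus form): a type occurring for a restriction `(A₀,B₀,C₀)·t`
occurs for `t`. [cite: BurgisserIkenmeyer2011, §3.1] -/
theorem not_hwvSpace_le_orbitVanishing_of_actTensor {t : Tensor ℂ m} {A₀ B₀ C₀ : Matrix (Fin m) (Fin m) ℂ}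
    {Λ : Fin 3 → Fin m → ℕ} {d : ℕ} (h : ¬ hwvSpace Λ d ≤ orbitVanishing (actTensor A₀ B₀ C₀ t)) :
    ¬ hwvSpace Λ d ≤ orbitVanishing t :=
  fun hle => h (hle.trans (orbitVanishing_le_orbitVanishing_actTensor t A₀ B₀ C₀))

end Density

/-! ### §2 The dictionary: pairings with translated highest-weight vectors are weight vectors of the calculus -/

section Dictionary

variable {m d : ℕ}

/-- Coordinate reversal commutes with the action up to reversing the matrices:
`((A,B,C)·s)(rev a, rev b, rev c) = ((Ǎ,B̌,Č)·š)(a,b,c)` with `Ǎ = A∘(rev × rev)`, `š = s∘rev³`. [bookkeeping] -/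
theorem actTensor_apply_rev (A B C : Matrix (Fin m) (Fin m) ℂ) (s : Tensor ℂ m) (a b c : Fin m) :
    actTensor A B C s (Fin.rev a) (Fin.rev b) (Fin.rev c) =
      actTensor (A.submatrix Fin.rev Fin.rev) (B.submatrix Fin.rev Fin.rev) (C.submatrix Fin.rev Fin.rev)
        (fun x y z => s (Fin.rev x) (Fin.rev y) (Fin.rev z)) a b c := by
  simp only [actTensor_apply, Matrix.submatrix_apply]
  symm
  refine Fintype.sum_bijective Fin.rev Fin.rev_involutive.bijective _ _ fun x => ?_
  refine Fintype.sum_bijective Fin.rev Fin.rev_involutive.bijective _ _ fun y => ?_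
  exact Fintype.sum_bijective Fin.rev Fin.rev_involutive.bijective _ _ fun z => rfl

/-- An invertible upper-triangular matrix has non-zero determinant. [bookkeeping] -/
theorem det_ne_zero_of_mem_borel {A : Matrix (Fin m) (Fin m) ℂ} (hA : A ∈ borel m) : A.det ≠ 0 := by
  rw [Matrix.det_of_upperTriangular (fun i j h => hA.1 i j h)]
  exact Finset.prod_ne_zero_iff.2 fun i _ => hA.2 i

/-- For `A ∈ B_m` the matrix `(A∘(rev × rev))ᵀ`, with entries `A (rev j) (rev i)`, lies in `B_m` again (conjugating by the
longest Weyl element swaps upper and lower triangular; transposing swaps back). [bookkeeping] -/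
theorem transpose_submatrix_rev_mem_borel {A : Matrix (Fin m) (Fin m) ℂ} (hA : A ∈ borel m) :
    (A.submatrix Fin.rev Fin.rev)ᵀ ∈ borel m := by
  refine ⟨fun i j hij => ?_, fun i => ?_⟩
  · simp only [Matrix.transpose_apply, Matrix.submatrix_apply]
    exact hA.1 _ _ (Fin.rev_lt_rev.2 hij)
  · simp only [Matrix.transpose_apply, Matrix.submatrix_apply]
    exact hA.2 _

/-- **Highest-weight vectors of the word model are `B_m`-eigenvectors of the reversed Kronecker power**: if
`ξ ∈ HW_λ((ℂ^m)^{⊗d})` and `A ∈ B_m` then `((A∘(rev × rev))ᵀ)^{⊗d} ξ = (∏_j A_{jj}^{Λ_j}) ξ` for the reversed exponent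
vector `Λ (rev i) = λ_i`. [cite: FultonHarrisGTM129, §15.3] -/
theorem powMat_mulVec_eq_weightChar_smul {lam : Nat.Partition d} {Λ₀ : Fin m → ℕ}
    (hΛ : ∀ i : Fin m, Λ₀ (Fin.rev i) = lam.sortedParts.getD i 0) {ξ : Word m d → ℂ}
    (hξ : ξ ∈ highestWeightSpace (wordRep ℂ m d) (Weight.ofPartition m lam)) {A : Matrix (Fin m) (Fin m) ℂ}
    (hA : A ∈ borel m) : powMat (A.submatrix Fin.rev Fin.rev)ᵀ d *ᵥ ξ = (weightChar Λ₀ A : ℂ) • ξ := by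
  classical
  have hB := transpose_submatrix_rev_mem_borel hA
  set g : GL (Fin m) ℂ := Matrix.GeneralLinearGroup.mkOfDetNeZero _ (det_ne_zero_of_mem_borel hB) with hg
  have hgU : IsUpperTriangular g := by
    intro i j hij
    rw [hg, Matrix.GeneralLinearGroup.val_mkOfDetNeZero]
    exact hB.1 i j hij
  have hact := hξ g hgU
  rw [wordRep_eq_powMat_mulVec, hg, Matrix.GeneralLinearGroup.val_mkOfDetNeZero] at hact
  rw [hact]
  congr 1
  -- the two characters agree: `∏_i A (rev i) (rev i) ^ λ_i = ∏_j A j j ^ Λ₀ j`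
  simp only [Literature.NumberTheory.DiophantineGeometry.weightChar, Weight.ofPartition,
    Matrix.GeneralLinearGroup.val_mkOfDetNeZero, Matrix.transpose_apply, Matrix.submatrix_apply, zpow_natCast,
    weightChar, ← hΛ]
  exact Fintype.prod_bijective Fin.rev Fin.rev_involutive.bijective _ _ fun i => rfl

/-- **The dictionary.**  For highest-weight vectors `ξ₁, ξ₂, ξ₃` of weights `λ⁰, λ¹, λ² ⊢ d` in the word models `(ℂ^m)^{⊗d}`
there is a weight vector `F ∈ hwvSpace Λ d` of the calculus, of the REVERSED type `Λ s (rev i) = λˢ_i`, whose value at a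
tensor `s` is the pairing `⟪(s∘rev³)^{⊗d}, ξ₁ ⊗ ξ₂ ⊗ ξ₃⟫` — explicitly `F = Σ_{u,v,w} (ξ₁ ⊗ ξ₂ ⊗ ξ₃)(u,v,w) ·
∏_p x_{rev u_p, rev v_p, rev w_p}`. (BI 2011 §10.1: highest weight vectors of `𝒪(W)_d` are obtained from those of
`W^{⊗d}` by polarisation.) [cite: BurgisserIkenmeyer2011, §10.1] [cite: FultonHarrisGTM129, §15.3] -/
theorem exists_pairing_mem_hwvSpace (lam : Fin 3 → Nat.Partition d) (Λ : Fin 3 → Fin m → ℕ)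
    (hΛ : ∀ (s : Fin 3) (i : Fin m), Λ s (Fin.rev i) = (lam s).sortedParts.getD i 0)
    {ξ₁ ξ₂ ξ₃ : Word m d → ℂ}
    (h₁ : ξ₁ ∈ highestWeightSpace (wordRep ℂ m d) (Weight.ofPartition m (lam 0)))
    (h₂ : ξ₂ ∈ highestWeightSpace (wordRep ℂ m d) (Weight.ofPartition m (lam 1)))
    (h₃ : ξ₃ ∈ highestWeightSpace (wordRep ℂ m d) (Weight.ofPartition m (lam 2))) :
    ∃ F ∈ hwvSpace Λ d, ∀ s : Tensor ℂ m, evalT s F =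
      ∑ u : Word m d, ∑ v : Word m d, ∑ w : Word m d,
        kroneckerPow (fun a b c => s (Fin.rev a) (Fin.rev b) (Fin.rev c)) d u v w * triad ξ₁ ξ₂ ξ₃ u v w := by
  classical
  set F : MvPolynomial (Idx m) ℂ := ∑ u : Word m d, ∑ v : Word m d, ∑ w : Word m d,
    (∏ p : Fin d, MvPolynomial.X (Fin.rev (u p), Fin.rev (v p), Fin.rev (w p))) *
      MvPolynomial.C (triad ξ₁ ξ₂ ξ₃ u v w) with hFdef
  have hFe : ∀ s : Tensor ℂ m, evalT s F = ∑ u : Word m d, ∑ v : Word m d, ∑ w : Word m d,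
      kroneckerPow (fun a b c => s (Fin.rev a) (Fin.rev b) (Fin.rev c)) d u v w * triad ξ₁ ξ₂ ξ₃ u v w := by
    intro s
    simp only [hFdef, evalT, map_sum, map_mul, map_prod, MvPolynomial.aeval_X, MvPolynomial.aeval_C,
      Algebra.algebraMap_self_apply, kroneckerPow_apply]
  refine ⟨F, ⟨?_, fun A B C hA hB hC s => ?_⟩, hFe⟩
  · -- homogeneity of degree `d`
    rw [hFdef]
    refine MvPolynomial.IsHomogeneous.sum _ _ _ fun u _ => MvPolynomial.IsHomogeneous.sum _ _ _ fun v _ =>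
      MvPolynomial.IsHomogeneous.sum _ _ _ fun w _ => ?_
    have hprod := MvPolynomial.IsHomogeneous.prod (Finset.univ : Finset (Fin d))
      (fun p => (MvPolynomial.X (Fin.rev (u p), Fin.rev (v p), Fin.rev (w p)) : MvPolynomial (Idx m) ℂ))
      (fun _ => 1) fun p _ => MvPolynomial.isHomogeneous_X ℂ _
    have hd : ∑ p ∈ (Finset.univ : Finset (Fin d)), (fun _ => 1) p = d := by simp
    rw [hd] at hprod
    simpa using hprod.mul (MvPolynomial.isHomogeneous_C (Idx m) (triad ξ₁ ξ₂ ξ₃ u v w))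
  · -- semi-invariance under `B_m³` with the reversed character
    rw [hFe, hFe]
    have hrev : (fun a b c => actTensor A B C s (Fin.rev a) (Fin.rev b) (Fin.rev c)) =
        actTensor (A.submatrix Fin.rev Fin.rev) (B.submatrix Fin.rev Fin.rev) (C.submatrix Fin.rev Fin.rev)
          (fun x y z => s (Fin.rev x) (Fin.rev y) (Fin.rev z)) :=
      funext fun a => funext fun b => funext fun c => actTensor_apply_rev A B C s a b c
    rw [hrev, kroneckerPow_actTensor_powMat, sum_actTensor_mul, transpose_powMat, transpose_powMat, transpose_powMat,
      actTensor_triad, powMat_mulVec_eq_weightChar_smul (hΛ 0) h₁ hA, powMat_mulVec_eq_weightChar_smul (hΛ 1) h₂ hB,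
      powMat_mulVec_eq_weightChar_smul (hΛ 2) h₃ hC, Finset.mul_sum]
    refine Finset.sum_congr rfl fun u _ => ?_
    rw [Finset.mul_sum]
    refine Finset.sum_congr rfl fun v _ => ?_
    rw [Finset.mul_sum]
    refine Finset.sum_congr rfl fun w _ => ?_
    simp only [triad_apply, Pi.smul_apply, smul_eq_mul]
    ring

end Dictionary

/-! ### §3 The bridge, direction ⟸: isotypic occurrence ⟹ occurrence in the calculus -/

section Bridge

variable {m d : ℕ}

/-- **Schur–Weyl bridge (⟸).**  If the partition triple `λ = (λ⁰,λ¹,λ²) ⊢ d` OCCURS in `t^{⊗d}` in the isotypic model —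
`isotypicSum₁ λ⁰ (isotypicSum₂ λ¹ (isotypicSum₃ λ² (kroneckerPow t d))) ≠ 0`, i.e. `(d;λ) ∈ S(t)` — then the reversed type
`(Λ, d)`, `Λ s (rev i) = λˢ_i`, OCCURS for `t` in the calculus: `¬ hwvSpace Λ d ≤ orbitVanishing t`.  Proof: occurrence gives
a translate `(A₀,B₀,C₀)` and highest-weight vectors with `⟪((A₀,B₀,C₀)·t)^{⊗d}, ξ₁⊗ξ₂⊗ξ₃⟫ ≠ 0` (tree, Schur–Weyl duality in
span form); the pairing polynomial `F` of §2 is a weight vector of type `(Λ,d)` with `F((Ǎ₀,B̌₀,Č₀)·t) ≠ 0` for the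
row-reversed matrices; by §1 a weight vector in `I(GL³·t)` would vanish at every `(A,B,C)·t`.
[cite: BurgisserIkenmeyer2011, §3.1 and §10.1] [cite: ChristandlVranaZuiddam2023, §3.1] -/
theorem not_hwvSpace_le_orbitVanishing_of_isotypicSum_ne_zero (t : Tensor ℂ m) (lam : Fin 3 → Nat.Partition d)
    (Λ : Fin 3 → Fin m → ℕ) (hΛ : ∀ (s : Fin 3) (i : Fin m), Λ s (Fin.rev i) = (lam s).sortedParts.getD i 0)
    (h : isotypicSum₁ (lam 0) (isotypicSum₂ (lam 1) (isotypicSum₃ (lam 2) (kroneckerPow t d))) ≠ 0) :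
    ¬ hwvSpace Λ d ≤ orbitVanishing t := by
  classical
  intro hle
  obtain ⟨A₀, B₀, C₀, ξ₁, ξ₂, ξ₃, h₁, h₂, h₃, hne⟩ := exists_pairing_ne_zero_of_isotypicSum₁₂₃_kroneckerPow_ne_zero h
  obtain ⟨F, hF, hFe⟩ := exists_pairing_mem_hwvSpace lam Λ hΛ h₁ h₂ h₃
  have h0 := evalT_actTensor_eq_zero_of_mem_orbitVanishing (hle hF) (A₀.submatrix Fin.rev id)
    (B₀.submatrix Fin.rev id) (C₀.submatrix Fin.rev id)
  have hrev : (fun a b c => actTensor (A₀.submatrix Fin.rev id) (B₀.submatrix Fin.rev id) (C₀.submatrix Fin.rev id) t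
      (Fin.rev a) (Fin.rev b) (Fin.rev c)) = actTensor A₀ B₀ C₀ t := by
    funext a b c
    simp only [actTensor_apply, Matrix.submatrix_apply, Fin.rev_rev, id]
  rw [hFe, hrev] at h0
  exact hne h0

/-- The same with the reversed type written out: `Λ s j = λˢ_{m−1−j}`. [cite: BurgisserIkenmeyer2011, §3.1 and §10.1] -/
theorem not_hwvSpace_rev_le_orbitVanishing_of_isotypicSum_ne_zero (t : Tensor ℂ m) (lam : Fin 3 → Nat.Partition d)
    (h : isotypicSum₁ (lam 0) (isotypicSum₂ (lam 1) (isotypicSum₃ (lam 2) (kroneckerPow t d))) ≠ 0) :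
    ¬ hwvSpace (fun s j => (lam s).sortedParts.getD (Fin.rev j) 0) d ≤ orbitVanishing t :=
  not_hwvSpace_le_orbitVanishing_of_isotypicSum_ne_zero t lam _ (fun s i => by simp only [Fin.rev_rev]) h

end Bridge

/-! ### §4 Imports: padding invariance; `S(⟨n,n,n⟩)` lands in the calculus -/

section Imports

variable {m : ℕ} {ι : Type} [Fintype ι]

/-- Zero-padding along `e` is the action of the `0/1` matrix of `e`: `pad_e t = (E ⊗ E ⊗ E)·t`, `E a i = [e i = a]`
(route-free copy of `ObstructionDescentCornerEquations.padTensor_eq_actTensor`, which lives above the `Theses` file). [bookkeeping] -/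
theorem padTensor_eq_actTensor_ind [DecidableEq ι] (e : ι → Fin m) (t : ι → ι → ι → ℂ) :
    padTensor e t = actTensor (fun a i => if e i = a then (1 : ℂ) else 0) (fun b j => if e j = b then (1 : ℂ) else 0)
      (fun c l => if e l = c then (1 : ℂ) else 0) t := by
  funext a b c
  rw [actTensor_apply]
  unfold padTensor
  rw [Fintype.sum_prod_type]
  refine Finset.sum_congr rfl fun i _ => ?_
  rw [Fintype.sum_prod_type]
  refine Finset.sum_congr rfl fun j _ => Finset.sum_congr rfl fun l _ => ?_
  by_cases h1 : e i = a <;> by_cases h2 : e j = b <;> by_cases h3 : e l = c <;> simp [h1, h2, h3]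

/-- Along an INJECTIVE `e` the transpose `0/1` matrix un-pads: `(Eᵀ ⊗ Eᵀ ⊗ Eᵀ)·pad_e t = t` (with `pad_e t = (E ⊗ E ⊗ E)·t`,
`padTensor_eq_actTensor_ind`). [bookkeeping] -/
theorem actTensor_padTensor_eq_self [DecidableEq ι] {e : ι → Fin m} (he : Function.Injective e)
    (t : ι → ι → ι → ℂ) :
    actTensor (fun (i : ι) (a : Fin m) => if e i = a then (1 : ℂ) else 0)
      (fun (i : ι) (a : Fin m) => if e i = a then (1 : ℂ) else 0)
      (fun (i : ι) (a : Fin m) => if e i = a then (1 : ℂ) else 0) (padTensor e t) = t := by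
  have hE : ∀ (E : Matrix (Fin m) ι ℂ) (E' : Matrix ι (Fin m) ℂ), (E = fun a i => if e i = a then (1 : ℂ) else 0) →
      (E' = fun i a => if e i = a then (1 : ℂ) else 0) → E' * E = 1 := by
    rintro E E' rfl rfl
    ext i i'
    rw [Matrix.mul_apply, Finset.sum_eq_single (e i)]
    · by_cases h : i = i'
      · subst h; simp
      · have hne : e i' ≠ e i := fun h' => h (he h').symm
        simp [Matrix.one_apply_ne h, hne]
    · intro a _ ha
      simp [Ne.symm ha]
    · intro h; exact absurd (Finset.mem_univ _) h
  rw [padTensor_eq_actTensor_ind, actTensor_actTensor, hE _ _ rfl rfl, actTensor_one]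

/-- **Zero-padding does not change isotypic occurrence**: for injective `e`, `λ` occurs in `(pad_e t)^{⊗d}` iff it occurs
in `t^{⊗d}` (the two tensors restrict to each other; occurrence is monotone under restriction, tree
`isotypicSum₁₂₃_kroneckerPow_ne_zero_of_actTensor`). [cite: BurgisserIkenmeyer2011, §3.1]
[cite: vandenBergChristandlLysikovNieuwboerWalterZuiddam2025, Prop. 2.7] -/
theorem isotypicSum_kroneckerPow_padTensor_ne_zero_iff [DecidableEq ι] {e : ι → Fin m} (he : Function.Injective e)
    (t : ι → ι → ι → ℂ) {d : ℕ} (lam : Fin 3 → Nat.Partition d) :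
    isotypicSum₁ (lam 0) (isotypicSum₂ (lam 1) (isotypicSum₃ (lam 2) (kroneckerPow (padTensor e t) d))) ≠ 0 ↔
      isotypicSum₁ (lam 0) (isotypicSum₂ (lam 1) (isotypicSum₃ (lam 2) (kroneckerPow t d))) ≠ 0 := by
  refine ⟨fun h => ?_, fun h => ?_⟩
  · rw [padTensor_eq_actTensor_ind] at h
    exact isotypicSum₁₂₃_kroneckerPow_ne_zero_of_actTensor h
  · have h' : isotypicSum₁ (lam 0) (isotypicSum₂ (lam 1) (isotypicSum₃ (lam 2) (kroneckerPow
        (actTensor (fun (i : ι) (a : Fin m) => if e i = a then (1 : ℂ) else 0)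
          (fun (i : ι) (a : Fin m) => if e i = a then (1 : ℂ) else 0)
          (fun (i : ι) (a : Fin m) => if e i = a then (1 : ℂ) else 0) (padTensor e t)) d))) ≠ 0 := by
      rwa [actTensor_padTensor_eq_self he]
    exact isotypicSum₁₂₃_kroneckerPow_ne_zero_of_actTensor h'

/-- The padding index map `(i,j) ↦ i·n + j` is injective. [bookkeeping] -/
theorem padIdx_injective' (n m : ℕ) (h : n * n ≤ m) : Function.Injective (padIdx n m h) :=
  fun _ _ hq => finProdFinEquiv.injective (Fin.castLE_injective h hq)

/-- **`S(⟨n,n,n⟩)` lands in the calculus.**  For EVERY format `m ≥ n²`: a partition triple `λ ⊢ d` occurring in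
`⟨n,n,n⟩^{⊗d}` (isotypic model) is, reversed (`Λ s (rev i) = λˢ_i`), a live type of the padded matrix multiplication
tensor: `¬ W_{Λ,d} ⊆ I(GL_m³·pad_m⟨n,n,n⟩)`.  First concrete member: the BI type `((2n²−3,1,1,1), 2^{n²}, 2^{n²}) ⊢ 2n²`,
`n ≥ 2` (tree: `isotypicSum_bi2011_kroneckerPow_matMulTensor_ne_zero`). [cite: BurgisserIkenmeyer2011, §3.1, Lemma 6.1] -/
theorem not_hwvSpace_le_orbitVanishing_padMM_of_isotypicSum_ne_zero (n m : ℕ) (h : n * n ≤ m) {d : ℕ}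
    (lam : Fin 3 → Nat.Partition d) (Λ : Fin 3 → Fin m → ℕ)
    (hΛ : ∀ (s : Fin 3) (i : Fin m), Λ s (Fin.rev i) = (lam s).sortedParts.getD i 0)
    (hocc : isotypicSum₁ (lam 0) (isotypicSum₂ (lam 1) (isotypicSum₃ (lam 2)
      (kroneckerPow (matMulTensor ℂ n n n) d))) ≠ 0) :
    ¬ hwvSpace Λ d ≤ orbitVanishing (padMM ℂ n m h) := by
  classical
  have hocc' := (isotypicSum_kroneckerPow_padTensor_ne_zero_iff (padIdx_injective' n m h)
    (matMulTensor ℂ n n n) lam).2 hocc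
  exact not_hwvSpace_le_orbitVanishing_of_isotypicSum_ne_zero (padMM ℂ n m h) lam Λ hΛ hocc'

/-- … hence for the unit tensor `⟨m⟩` of every format `m ≥ R(⟨n,n,n⟩)` (then `pad_m⟨n,n,n⟩ ∈ Mat_m³·⟨m⟩` and
`I(σ_m) ⊆ I(pad_m⟨n,n,n⟩)`, tree `orbitVanishing_unitTensor_le`): every element of `S(⟨n,n,n⟩)` occurs, reversed, in
`ℂ[σ_m]`. [cite: BurgisserIkenmeyer2011, §3.1 and Prop. 3.3] -/
theorem not_hwvSpace_le_orbitVanishing_unitTensor_of_isotypicSum_ne_zero (n m : ℕ) (h : n * n ≤ m)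
    (hr : tensorRank (matMulTensor ℂ n n n) ≤ m) {d : ℕ} (lam : Fin 3 → Nat.Partition d) (Λ : Fin 3 → Fin m → ℕ)
    (hΛ : ∀ (s : Fin 3) (i : Fin m), Λ s (Fin.rev i) = (lam s).sortedParts.getD i 0)
    (hocc : isotypicSum₁ (lam 0) (isotypicSum₂ (lam 1) (isotypicSum₃ (lam 2)
      (kroneckerPow (matMulTensor ℂ n n n) d))) ≠ 0) :
    ¬ hwvSpace Λ d ≤ orbitVanishing (unitTensor ℂ m) := by
  obtain ⟨A, B, C, hABC⟩ := exists_fromCols_eq_padMM (R := ℂ) h hr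
  exact fun hle => not_hwvSpace_le_orbitVanishing_padMM_of_isotypicSum_ne_zero n m h lam Λ hΛ hocc
    (hle.trans (orbitVanishing_unitTensor_le hABC))

end Imports

end Summit.MatrixMultiplication.MatrixMultiplication.Theorems.ObstructionCalculus

end
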